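import Literature.Probability.LatticeModels.FatRectanglePoincareScaling
import HarnessLib

/-!
# Strong mixing ⇒ spectral gap uniform in all fat rectangles ([Mar99] Theorem 4.5), DISCHARGED

Topic `Literature/Probability/LatticeModels`; cell `ym-ir`, seat lit-3 (census rows B2/B4 «DS mixing ⇔ uniform
gap ⇔ uniform LSI (discrete sibling)»).  This file DISCHARGES the typed fact `Glauber.Martinelli1999_thm4_5`
(`GlauberDynamicsStrongMixing.lean`): `theorem Glauber.Martinelli1999_thm4_5_holds`, no new named fact
(D-0026).  [Mar99] Theorem 4.5 p0187 L22–27, proof p0188 L6 – p0190 L16: in `d = 2`, `SMT(R, l, m)` on all fat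
rectangles implies (i) the recursion `g(2L) ≥ (1 − k/√L) g(L)` for the worst heat-bath spectral gap over `𝓡_L`
(here with `k = 300`, from three applications of `Glauber.fatRectangles_poincare_step_rate`:
`L → ⌊4L/3⌋ → ⌊4⌊4L/3⌋/3⌋ → … ⊇ 2L`), and (ii) `inf_L g(L) > 0` (the recursion from a base scale `L₂ ≥ 4k²`,
where [Mar99] Theorem 3.8 — `Glauber.Martinelli1999_thm3_8_holds` — bounds the gap of every `R ∈ 𝓡_{L₂}` below,
and `Π_i (1 − k/√(2^i L₂)) ≥ exp(−8k/√L₂) > 0`).  The chain of PROVED ingredients: Proposition 3.4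
(`GlauberDynamicsStrongMixing`), Proposition 3.5 (`GlauberTwoBlockGap`), Proposition 2.12 in event form and the
sub-volume step (`GibbsRelativeDensitySMT`), (4.14)–(4.16) (`GlauberOverlapAveraging`), the box split
(`BoxSplitTwoBlockGap`, `BoxFamilyPoincare`), fat rectangles (`FatRectangleBoxes`, `FatRectanglePoincareStep`,
`FatRectanglePoincareScaling`).  CAVEAT recorded there: the printed proof applies Proposition 2.12 with
`SMT(R_n^top ∖ A₀)`, outside the fat-rectangle hypothesis; the formal proof uses `SMT` only on fat `ρ`-boxes
inside the overlap strips.  SIBLING-SETTING result (`±1` spins, finite range); nothing here concerns gauge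
theories or the Yang–Mills mass gap. [cite: Martinelli1999, Theorem 4.5]
-/

open MeasureTheory ProbabilityTheory Finset Filter Topology

noncomputable section

namespace Literature.Probability.LatticeModels

namespace Glauber

variable {r : ℕ} (U : FRPotential 2 ℤˣ r) (β : ℝ)

set_option maxHeartbeats 1600000 in
/-- **[Mar99] Theorem 4.5, first part: `g(2L) ≥ (1 − k/√L) g(L)`** with `k = 300`, for `L` large.
[cite: Martinelli1999, Theorem 4.5] -/
theorem fatRectangles_poincare_doubling {lS : ℕ} {m : ℝ} (hm : 0 < m)
    (hSMT : ∀ L : ℕ, ∀ Q ∈ fatRectangles L, SMT (U.spec β) Q lS m) :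
    ∃ k : ℝ, 0 < k ∧ ∃ L₁ : ℕ, ∀ L : ℕ, L₁ ≤ L → ∀ g : ℝ, 0 ≤ g →
      (∀ R ∈ fatRectangles L, ∀ τ : Site 2 → ℤˣ, PoincareIneq (U.spec β R τ) R g) →
        ∀ R ∈ fatRectangles (2 * L), ∀ τ : Site 2 → ℤˣ,
          PoincareIneq (U.spec β R τ) R ((1 - k / Real.sqrt L) * g) := by
  obtain ⟨L₁, hL₁⟩ := fatRectangles_poincare_step_rate U β hm hSMT
  refine ⟨300, by norm_num, max L₁ 9, ?_⟩
  intro L hL g hg hPI R hR τ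
  have hL₁L : L₁ ≤ L := le_trans (le_max_left _ _) hL
  have hL9 : 9 ≤ L := le_trans (le_max_right _ _) hL
  have hLpos : (0 : ℝ) < L := by exact_mod_cast (show 0 < L by omega)
  have hsq : 0 < Real.sqrt L := Real.sqrt_pos.2 hLpos
  -- trivial when the factor is nonpositive
  by_cases hbig : Real.sqrt L ≤ 300
  · refine PoincareIneq.of_nonpos (mul_nonpos_of_nonpos_of_nonneg ?_ hg)
    rw [sub_nonpos, le_div_iff₀ hsq]; linarith
  rw [not_le] at hbig
  -- the three scales
  set L1 := 4 * L / 3 with hL1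
  set L2 := 4 * L1 / 3 with hL2
  set L3 := 4 * L2 / 3 with hL3
  have h01 : L ≤ L1 := by omega
  have h12 : L1 ≤ L2 := by omega
  have h3 : 2 * L ≤ L3 := by omega
  have hs1 : 3 * L1 ≤ 4 * L := by omega
  have hs2 : 3 * L2 ≤ 4 * L1 := by omega
  have hs3 : 3 * L3 ≤ 4 * L2 := by omega
  set u : ℝ := 1 - 100 / Real.sqrt L with hu
  have hu0 : 0 < u := by rw [hu, sub_pos, div_lt_one hsq]; linarith
  have hfac : ∀ L' : ℕ, L ≤ L' → u ≤ 1 - 100 / Real.sqrt L' := by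
    intro L' hLL'
    have h1 : Real.sqrt L ≤ Real.sqrt L' := Real.sqrt_le_sqrt (by exact_mod_cast hLL')
    have h2 : 100 / Real.sqrt L' ≤ 100 / Real.sqrt L := div_le_div_of_nonneg_left (by norm_num) hsq h1
    rw [hu]; linarith
  -- step 1: `𝓡_L → 𝓡_{L1}`
  have step1 := hL₁ L hL₁L g hg hPI L1 hs1
  have hg1 : 0 ≤ (1 - 100 / Real.sqrt L) * g := mul_nonneg hu0.le hg
  -- step 2: `𝓡_{L1} → 𝓡_{L2}`
  have step2 := hL₁ L1 (le_trans hL₁L h01) _ hg1 step1 L2 hs2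
  have hu1 : 0 ≤ 1 - 100 / Real.sqrt L1 := hu0.le.trans (hfac L1 h01)
  have hg2 : 0 ≤ (1 - 100 / Real.sqrt L1) * ((1 - 100 / Real.sqrt L) * g) := mul_nonneg hu1 hg1
  -- step 3: `𝓡_{L2} → 𝓡_{L3} ⊇ 𝓡_{2L}`
  have step3 := hL₁ L2 (le_trans hL₁L (h01.trans h12)) _ hg2 step2 L3 hs3 R (fatRectangles_mono h3 hR) τ
  refine step3.mono ?_
  have hu2 : u ≤ 1 - 100 / Real.sqrt L2 := hfac L2 (h01.trans h12)
  have hu1' : u ≤ 1 - 100 / Real.sqrt L1 := hfac L1 h01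
  have hprod : u ^ 3 ≤ (1 - 100 / Real.sqrt L2) * ((1 - 100 / Real.sqrt L1) * (1 - 100 / Real.sqrt L)) := by
    have : u ^ 3 = u * (u * u) := by ring
    rw [this]
    exact mul_le_mul hu2 (mul_le_mul hu1' le_rfl hu0.le hu1) (by positivity) (hu0.le.trans hu2)
  have hcube : 1 - 300 / Real.sqrt L ≤ u ^ 3 := by
    have hy : 0 ≤ 100 / Real.sqrt L := by positivity
    have hy1 : 100 / Real.sqrt L ≤ 1 := by rw [div_le_one hsq]; linarith
    have e3 : 1 - 300 / Real.sqrt L = 1 - 3 * (100 / Real.sqrt L) := by ring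
    have e4 : u ^ 3 = 1 - 3 * (100 / Real.sqrt L) + (100 / Real.sqrt L) ^ 2 * (3 - 100 / Real.sqrt L) := by
      rw [hu]; ring
    rw [e3, e4]
    nlinarith [mul_nonneg (sq_nonneg (100 / Real.sqrt L)) (show (0 : ℝ) ≤ 3 - 100 / Real.sqrt L by linarith)]
  calc (1 - 300 / Real.sqrt L) * g ≤ u ^ 3 * g := mul_le_mul_of_nonneg_right hcube hg
    _ ≤ (1 - 100 / Real.sqrt L2) * ((1 - 100 / Real.sqrt L1) * (1 - 100 / Real.sqrt L)) * g :=
        mul_le_mul_of_nonneg_right hprod hg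
    _ = (1 - 100 / Real.sqrt ↑L2) * ((1 - 100 / Real.sqrt ↑L1) * ((1 - 100 / Real.sqrt ↑L) * g)) := by ring

/-- `e^{−2x} ≤ 1 − x` for `0 ≤ x ≤ ½`. [folklore] -/
private theorem exp_neg_two_mul_le {x : ℝ} (hx0 : 0 ≤ x) (hx : x ≤ 1 / 2) : Real.exp (-(2 * x)) ≤ 1 - x := by
  have h1 : 2 * x + 1 ≤ Real.exp (2 * x) := Real.add_one_le_exp (2 * x)
  have h2 : Real.exp (-(2 * x)) = (Real.exp (2 * x))⁻¹ := Real.exp_neg _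
  rw [h2, inv_le_comm₀ (Real.exp_pos _) (by linarith)]
  calc (1 - x)⁻¹ ≤ 2 * x + 1 := by
        rw [inv_le_iff_one_le_mul₀ (by linarith)]; nlinarith
    _ ≤ Real.exp (2 * x) := h1

set_option maxHeartbeats 1600000 in
/-- **[Mar99] Theorem 4.5, second part: `inf_L g(L) > 0`** — a spectral gap uniform in all fat rectangles and
boundary conditions. [cite: Martinelli1999, Theorem 4.5] -/
theorem fatRectangles_uniform_gap {lS : ℕ} {m : ℝ} (hm : 0 < m)
    (hSMT : ∀ L : ℕ, ∀ Q ∈ fatRectangles L, SMT (U.spec β) Q lS m) :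
    ∃ g : ℝ, 0 < g ∧ ∀ (L : ℕ), ∀ R ∈ fatRectangles L, ∀ τ : Site 2 → ℤˣ, PoincareIneq (U.spec β R τ) R g := by
  classical
  obtain ⟨k, hk, L₁, hL₁⟩ := fatRectangles_poincare_doubling U β hm hSMT
  obtain ⟨K, hK⟩ := Martinelli1999_thm3_8_holds U (le_refl 2) β
  -- base scale `L₂ ≥ max(L₁, 1, 4k²)`
  set L₂ : ℕ := max (max L₁ 1) ⌈4 * k ^ 2⌉₊ with hL₂
  have hL₂1 : 1 ≤ L₂ := le_trans (le_max_right _ _) (le_max_left _ _)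
  have hL₂L₁ : L₁ ≤ L₂ := le_trans (le_max_left _ _) (le_max_left _ _)
  have hL₂k : 4 * k ^ 2 ≤ (L₂ : ℝ) := le_trans (Nat.le_ceil _) (by exact_mod_cast le_max_right _ _)
  have hL₂pos : (0 : ℝ) < L₂ := by exact_mod_cast hL₂1
  -- base gap from Theorem 3.8
  set g₀ : ℝ := (1 / 2) * Real.exp (-(|K| * L₂)) with hg₀
  have hg₀pos : 0 < g₀ := by positivity
  have hbase : ∀ R ∈ fatRectangles L₂, ∀ τ : Site 2 → ℤˣ, PoincareIneq (U.spec β R τ) R g₀ := by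
    intro R hR τ
    refine (hK R τ).mono ?_
    obtain ⟨a, b, rfl, hpos, -, hle⟩ := exists_IcoBox_of_mem_fatRectangles hR
    have hcard : ((Fintype.piFinset fun i => Finset.Ico (a i) (b i)).card : ℝ) ≤ (L₂ : ℝ) ^ 2 := by
      have h : (Fintype.piFinset fun i => Finset.Ico (a i) (b i)).card ≤ L₂ * L₂ := by
        rw [card_IcoBox, Fin.prod_univ_two]
        have h0 : (b 0 - a 0).toNat ≤ L₂ := by have := hle 0; omega
        have h1 : (b 1 - a 1).toNat ≤ L₂ := by have := hle 1; omega
        exact Nat.mul_le_mul h0 h1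
      have : (((Fintype.piFinset fun i => Finset.Ico (a i) (b i)).card : ℕ) : ℝ) ≤ ((L₂ * L₂ : ℕ) : ℝ) := by
        exact_mod_cast h
      push_cast at this; nlinarith
    have hexp : (((2 : ℕ) : ℝ) - 1) / ((2 : ℕ) : ℝ) = 1 / 2 := by norm_num
    rw [hexp, ← Real.sqrt_eq_rpow]
    have hsq : Real.sqrt ((Fintype.piFinset fun i => Finset.Ico (a i) (b i)).card : ℝ) ≤ L₂ :=
      calc Real.sqrt ((Fintype.piFinset fun i => Finset.Ico (a i) (b i)).card : ℝ) ≤ Real.sqrt ((L₂ : ℝ) ^ 2) :=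
            Real.sqrt_le_sqrt hcard
        _ = L₂ := Real.sqrt_sq hL₂pos.le
    rw [hg₀]
    refine mul_le_mul_of_nonneg_left (Real.exp_le_exp.2 ?_) (by norm_num)
    have h1 : K * Real.sqrt ((Fintype.piFinset fun i => Finset.Ico (a i) (b i)).card : ℝ) ≤ |K| * L₂ := by
      calc K * Real.sqrt _ ≤ |K| * Real.sqrt ((Fintype.piFinset fun i => Finset.Ico (a i) (b i)).card : ℝ) :=
            mul_le_mul_of_nonneg_right (le_abs_self K) (Real.sqrt_nonneg _)
        _ ≤ |K| * L₂ := mul_le_mul_of_nonneg_left hsq (abs_nonneg K)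
    linarith
  -- the recursion along the scales `2^i L₂`, with the accumulated loss `exp(−2k T_i)`,
  -- `T_i = Σ_{i'<i} (3/4)^{i'} / √L₂ ≥ Σ_{i'<i} 1/√(2^{i'} L₂)`
  have hrec : ∀ i : ℕ, ∀ R ∈ fatRectangles (2 ^ i * L₂), ∀ τ : Site 2 → ℤˣ,
      PoincareIneq (U.spec β R τ) R
        (g₀ * Real.exp (-(2 * k * ((∑ i' ∈ Finset.range i, (3 / 4 : ℝ) ^ i') / Real.sqrt L₂)))) := by
    intro i
    induction i with
    | zero =>
      intro R hR τ
      simp only [Finset.range_zero, Finset.sum_empty, zero_div, mul_zero, neg_zero, Real.exp_zero, mul_one,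
        pow_zero, one_mul] at hR ⊢
      exact hbase R hR τ
    | succ i ih =>
      intro R hR τ
      set c : ℝ := g₀ * Real.exp (-(2 * k * ((∑ i' ∈ Finset.range i, (3 / 4 : ℝ) ^ i') / Real.sqrt L₂)))
        with hc
      have hc0 : 0 ≤ c := by positivity
      have hscale : L₁ ≤ 2 ^ i * L₂ := le_trans hL₂L₁ (Nat.le_mul_of_pos_left L₂ (by positivity))
      have hR' : R ∈ fatRectangles (2 * (2 ^ i * L₂)) := by
        have : 2 ^ (i + 1) * L₂ = 2 * (2 ^ i * L₂) := by ring
        rwa [this] at hR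
      have h := hL₁ (2 ^ i * L₂) hscale c hc0 ih R hR' τ
      refine h.mono ?_
      -- `g₀ e^{−2k T_{i+1}} ≤ (1 − k/√(2^i L₂)) · g₀ e^{−2k T_i}`
      set x : ℝ := k / Real.sqrt ((2 ^ i * L₂ : ℕ) : ℝ) with hx
      have hsqL : 0 < Real.sqrt ((2 ^ i * L₂ : ℕ) : ℝ) := Real.sqrt_pos.2 (by positivity)
      have hx0 : 0 ≤ x := by positivity
      -- `x ≤ 1/2` since `√(2^i L₂) ≥ √L₂ ≥ 2k`
      have hsqL₂ : 2 * k ≤ Real.sqrt L₂ := by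
        rw [Real.le_sqrt (by positivity) hL₂pos.le]; nlinarith
      have hmono : Real.sqrt L₂ ≤ Real.sqrt ((2 ^ i * L₂ : ℕ) : ℝ) := by
        refine Real.sqrt_le_sqrt ?_
        have : L₂ ≤ 2 ^ i * L₂ := Nat.le_mul_of_pos_left L₂ (by positivity)
        exact_mod_cast this
      have hx12 : x ≤ 1 / 2 := by
        rw [hx, div_le_iff₀ hsqL]; linarith
      -- `(3/4)^i / √L₂ ≥ 1/√(2^i L₂)`, i.e. `(4/3)^i √L₂ ≤ √(2^i L₂)`… used as `x ≤ k (3/4)^i / √L₂`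
      have hgeom : x ≤ k * ((3 / 4 : ℝ) ^ i / Real.sqrt L₂) := by
        rw [hx, div_eq_mul_one_div k, mul_comm k, mul_comm k]
        refine mul_le_mul_of_nonneg_right ?_ hk.le
        -- `1/√(2^i L₂) ≤ (3/4)^i/√L₂`
        rw [div_le_div_iff₀ hsqL (Real.sqrt_pos.2 hL₂pos), one_mul]
        have h1 : Real.sqrt ((2 ^ i * L₂ : ℕ) : ℝ) = Real.sqrt ((2 : ℝ) ^ i) * Real.sqrt L₂ := by
          push_cast; exact Real.sqrt_mul (by positivity) _
        rw [h1, ← mul_assoc]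
        refine le_mul_of_one_le_left (Real.sqrt_nonneg _) ?_
        -- `1 ≤ (3/4)^i √(2^i)`: `(3/4)^i √(2^i) ≥ (3/4)^i (4/3)^i = 1` since `(4/3)^2 ≤ 2`
        have h2 : ((4 : ℝ) / 3) ^ i ≤ Real.sqrt ((2 : ℝ) ^ i) := by
          rw [Real.le_sqrt (by positivity) (by positivity), ← pow_mul, mul_comm, pow_mul]
          exact pow_le_pow_left₀ (by positivity) (by norm_num) i
        calc (1 : ℝ) = (3 / 4 : ℝ) ^ i * (4 / 3 : ℝ) ^ i := by rw [← mul_pow]; norm_num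
          _ ≤ (3 / 4 : ℝ) ^ i * Real.sqrt ((2 : ℝ) ^ i) := mul_le_mul_of_nonneg_left h2 (by positivity)
      have hstep : Real.exp (-(2 * k * ((∑ i' ∈ Finset.range (i + 1), (3 / 4 : ℝ) ^ i') / Real.sqrt L₂))) ≤
          (1 - x) * Real.exp (-(2 * k * ((∑ i' ∈ Finset.range i, (3 / 4 : ℝ) ^ i') / Real.sqrt L₂))) := by
        rw [Finset.sum_range_succ, add_div, mul_add, neg_add, Real.exp_add, mul_comm]
        refine mul_le_mul_of_nonneg_right ?_ (Real.exp_pos _).le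
        calc Real.exp (-(2 * k * ((3 / 4 : ℝ) ^ i / Real.sqrt L₂))) ≤ Real.exp (-(2 * x)) := by
              rw [Real.exp_le_exp]; nlinarith [hgeom]
          _ ≤ 1 - x := exp_neg_two_mul_le hx0 hx12
      calc g₀ * Real.exp (-(2 * k * ((∑ i' ∈ Finset.range (i + 1), (3 / 4 : ℝ) ^ i') / Real.sqrt L₂)))
          ≤ g₀ * ((1 - x) * Real.exp (-(2 * k * ((∑ i' ∈ Finset.range i, (3 / 4 : ℝ) ^ i') / Real.sqrt L₂)))) :=
            mul_le_mul_of_nonneg_left hstep hg₀pos.le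
        _ = (1 - x) * c := by rw [hc]; ring
  -- the uniform constant
  set gstar : ℝ := g₀ * Real.exp (-(2 * k * (4 / Real.sqrt L₂))) with hgstar
  refine ⟨gstar, by positivity, fun L R hR τ => ?_⟩
  have hLi : L ≤ 2 ^ L * L₂ := le_trans (Nat.lt_two_pow_self).le (Nat.le_mul_of_pos_right _ (by omega))
  refine (hrec L R (fatRectangles_mono hLi hR) τ).mono ?_
  rw [hgstar]
  refine mul_le_mul_of_nonneg_left (Real.exp_le_exp.2 ?_) hg₀pos.le
  have hsum : (∑ i' ∈ Finset.range L, (3 / 4 : ℝ) ^ i') ≤ 4 := by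
    rw [geom_sum_eq (by norm_num) L]
    have : (0 : ℝ) ≤ (3 / 4 : ℝ) ^ L := by positivity
    have h2 : ((3 / 4 : ℝ) ^ L - 1) / ((3 / 4 : ℝ) - 1) = 4 * (1 - (3 / 4 : ℝ) ^ L) := by
      field_simp; ring
    rw [h2]; nlinarith
  have hsqpos : 0 < Real.sqrt L₂ := Real.sqrt_pos.2 hL₂pos
  have : (∑ i' ∈ Finset.range L, (3 / 4 : ℝ) ^ i') / Real.sqrt L₂ ≤ 4 / Real.sqrt L₂ :=
    div_le_div_of_nonneg_right hsum hsqpos.le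
  nlinarith [hk]

/-- **[Mar99] Theorem 4.5 — DISCHARGED**: strong mixing `SMT(R, l, m)` on all fat rectangles implies the
recursive gap bound `g(2L) ≥ (1 − k/√L) g(L)` (`k = 300`, `L` large) and a spectral gap of the heat-bath
Glauber dynamics bounded away from zero uniformly in all fat rectangles and boundary conditions.  Closes the
named fact `Glauber.Martinelli1999_thm4_5` (the binder `U` is the fact's own parameter).
[cite: Martinelli1999, Theorem 4.5] -/
theorem Martinelli1999_thm4_5_holds : Martinelli1999_thm4_5 U := by
  intro β l m hm hSMT
  exact ⟨fatRectangles_poincare_doubling U β hm hSMT, fatRectangles_uniform_gap U β hm hSMT⟩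

end Glauber

end Literature.Probability.LatticeModels

end
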